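import Summits.AtomisticToContinuum.Crystallization.Theses.PhononSlackCertificates
import Summits.AtomisticToContinuum.Crystallization.Theorems.ChargedEnergyGap.Negative.BlocksBound

/-!
# Disproof of `NearFieldConvexity` (stmt-AtomisticToContinuum-13958) — findings of the standing
# disprover (cycle 1, 2026-08-16).  VERDICT SO FAR: NO KILL; four load-bearing facts certified.

Crux (route `PhononSlackCertificates`, rank 3; read-back `nearFieldConvexity_iff_radius`, `Iff.rfl`):
`∀ δ>0 ∀ η>0 ∃ c>0 ∃ C ∀ δ-separated x ∀ Ω ⊆ {1/20-good}:`
`c·#NL_η(Ω) − C·#∂₄Ω ≤ Σ_{i∈Ω} (e_i − e*)`, `e_i = ½·siteEnergy`, `e* = ⨅_Q e_LJ(Q)`.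

INDEX (letters as in the cdisprove protocol; everything below is sorry-free and is being landed as
`Theorems/NearFieldConvexity/Negative/Comb.lean` (p99818, ACCEPTED) + `Negative/LoadBearing.lean`):

(a) LOAD-BEARING HYPOTHESES — one witness, the COLLINEAR COMB `comb M` (perfect fcc two-shell
    cluster `{0} ∪ fccTwoShellPattern`, centre `0`-good at scale 1, plus `M` far particles
    `(2 + k/(2M))·e₀` on `[2, 5/2)`; `1/(2M)`-separated; centre site energy `≤ −M/2000`;
    `Ω = {centre}` has `#∂ ≤ 1`, `#NL ≤ 1`; `e* ≥ −2³²/12`):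
    * `nearFieldConvexity_false_without_separation` : ¬ (crux with the separation hypothesis dropped);
    * `not_nearFieldConvexityUniform` : ¬ (∃ c C BEFORE ∀ δ) — `C = C(δ) → ∞` forced (comb gives
      `C(δ) ≥ 1/(8000δ) − 2³²/12`; true order `δ⁻³`, the r⁻⁶ pull of δ-dense matter beyond 3a/2);
    * `nearFieldConvexity_false_without_boundaryCharge` : ¬ (crux with `C = 0`);
    * on paper only (no cheap Lean model): `η > 0` and `c = c(η)` are load-bearing (a generic
      `τ`-jiggle of optimal hcp is good, nowhere EXACTLY layered, costs `κτ²N → 0`; a uniform shear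
      `γ ≳ η/2` is good for `γ ≤ 1/20`, non-η-layered, costs `½μγ²` per particle, so `c(η) ≲ μη²`);
      goodness of `Ω` is what the near-field expansion needs but dropping it gives no cheap
      counterexample either (a non-layered near-minimiser would be needed — the open problem again).
(b) TIGHTNESS / BOUNDARY: `not_nearFieldConvexityRadius_of_lt_one` : the boundary collar radius
    (`4`) cannot go below the contact distance `1`; the collar may plausibly shrink to any `r > 1`
    (not tested: cherry-picking a sublattice of a polytype makes every site boundary once `r ≥ a`).
(c) NATURAL STRENGTHENINGS refuted: uniform-in-δ constants, `C = 0`, collar `< 1` (above).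
(d) TARGETS (line `Sketch`, lead prover-line-…-13958-0; no stuck stubs posted yet): on paper
    `stub_tractionHalfStress` (pair `l ↔ σ l`), `stub_schurStepAntitone` (`Y ⪰ X ≻ 0 ⇒ X⁻¹ ⪰ Y⁻¹`),
    `stub_barrierTwoBlocks` (`A ⪰ X ≻ 0 ⇒ D − BᴴA⁻¹B ⪰ D − BᴴX⁻¹B`, `PosSemidef.fromBlocks₁₁`) and
    `stub_transfer` (bookkeeping) are TRUE; `stub_pointwise` (C⁺) is the crux plus a flow
    decomposition — note (ii) at `Ω = B(xᵢ,4) ∩ X` (interior `= {i}`, `#∂₄ ≤ 420`) silently forces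
    `gᵢ + Σⱼ|τᵢⱼ| ≤ 420·C` at every interior-type site, so the transfer is implicitly BOUNDED; no
    cheap kill.  Nothing broken: 0 targets, 0 broken.
(e) WHY THE CRUX RESISTS (near-misses, no sorries kept):
    * FAR FIELD at fixed δ is harmless: `Σ_{i∈Ω} e_i = E(x|_Ω) + ½Σ_{i∈Ω,j∉Ω} V`, `E(x|_Ω) ≥ |Ω|e*`
      (periodisation, `card_mul_iInf_le_interactionEnergy`), boundary sites `≥ −(250/12)δ⁻⁶`
      (`neg_le_siteEnergy_of_separated`), and the pull of non-Ω matter on the radius-4 interior is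
      `≤ K(δ)·#∂₄Ω` — the INTERFACE BOUND `InterfaceBound` below (ball Ω of radius L inside a
      δ-cloud: pull ~ K δ⁻³ L² vs #∂ ~ 6 L²; cavity of radius r: pull ~ 0.1 δ⁻³ r², #∂ ~ 50 r²; a
      tiny cavity radiates d⁻⁶, not d⁻³, so the `log diam Ω` of naive dyadic charging is an
      artefact).  The crux IMPLIES the floor `BoundaryFloor` (`nearFieldConvexity_implies_floor`),
      which is exactly this far-field content; provers should land it first.
    * NEAR FIELD: interior sites of a Bravais piece have `e_i ≥ e(Q) ≥ e*` (dropped terms beyond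
      `0.89` are negative), relaxed Barlow polytypes keep hole registry (3-fold axes through every
      site) and are EXACTLY layered with free `a`, `c/a`, spacings, so a kill needs a 1/20-good bulk
      phase, non-η-layered on a positive fraction, with energy density `e*`: a degenerate LJ ground
      state or an elastic/phonon instability of a relaxed Barlow stacking.  None known.  NUMERICS
      (kit job j017384, cutoff 6.5 + tail, attached to the item): relaxed fcc/hcp/dhcp/6H/9R have
      `a = 0.9713–0.9714`, spacings/a `= 0.8164–0.8165` (inside the box), two-shell goodness margins
      `≤ 0.001` (tolerance `0.05`), energies `e_hcp = −0.717562 < 9R (+2.1e-5) < dhcp (+4.9e-5) <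
      6H (+7.3e-5) < fcc (+1.14e-4)` (relative), NO negative eigenvalue of the dynamical matrix on a
      10×10×6 BZ grid for any of them, acoustic slopes `λ_min/|k|² ∈ [1.87, 4.59]` (fcc) /
      `[2.68, 2.93]` (hcp); hcp excess per particle at the box edges `a = 0.94: +0.034`, `a = 1:
      +0.018`; uniform basal shear `γ`: `≈ 1.3 γ²`, in-plane pure shear `g`: `≈ 6.5 g²` — so the
      crux's `c(η)` can be at most `~ η²` (order `1e-4` at `η = 0.01`) but no zero-cost non-layered
      good deformation appeared.  The definitions were audited: `hcpInt ∪ hcpSecondShellInt` is the true hcp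
      18-neighbourhood (mirror triple `(2,−4,−4)` etc.), `barlowOffset = (u+v)/3`, `haggLabel` of the
      alternating/constant words give hcp/fcc, so optimal hcp IS in the layered family (no
      definitional kill).
-/

noncomputable section

open scoped BigOperators
open Literature.MathematicalPhysics.StatisticalMechanics Literature.Geometry.DiscreteGeometry

namespace Summit.AtomisticToContinuum.Crystallization.Cruxes.NearFieldConvexity.Disproof

open Summit.AtomisticToContinuum.Crystallization.Theses.PhononSlackCertificates (NearFieldConvexity)
open Summit.AtomisticToContinuum.Crystallization.Theorems.ChargedEnergyGapNegative (eStar)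

local notation "E3" => EuclideanSpace ℝ (Fin 3)

/-! ## Scalar facts -/

/-- `V_LJ ≤ −1/2000` on the comb annulus `[2, 5/2]`
(`r⁻¹² ≤ 2⁻¹²`, `r⁻⁶ ≥ (2/5)⁶`). [cite: BlancLewin2015, §1.1 (3)] -/
theorem lennardJones_le_on_annulus {r : ℝ} (h1 : 2 ≤ r) (h2 : r ≤ 5 / 2) :
    lennardJones r ≤ -(1 / 2000) := by
  unfold lennardJones
  have hr : 0 < r := by linarith
  have h0 : 0 ≤ r⁻¹ := inv_nonneg.2 hr.le
  have ha : r⁻¹ ≤ 1 / 2 := by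
    rw [inv_eq_one_div]
    exact one_div_le_one_div_of_le (by norm_num) h1
  have hb : 2 / 5 ≤ r⁻¹ := by
    rw [inv_eq_one_div, div_le_div_iff₀ (by norm_num) hr]
    linarith
  have h12 : r⁻¹ ^ 12 ≤ (1 / 2) ^ 12 := pow_le_pow_left₀ h0 ha 12
  have h6 : (2 / 5 : ℝ) ^ 6 ≤ r⁻¹ ^ 6 := pow_le_pow_left₀ (by norm_num) hb 6
  norm_num at h12 h6 ⊢
  linarith

/-! ## The comb witness -/

/-- `δ`-separation of a finite configuration (the crux's hypothesis, verbatim). -/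
def Separated {N : ℕ} (δ : ℝ) (x : Fin N → E3) : Prop :=
  ∀ i j : Fin N, i ≠ j → δ ≤ dist (x i) (x j)

/-- Decoding of the index type `Fin (M + 18 + 1)`: `M` far particles, `18` pattern points, the centre. -/
def combIdx (M : ℕ) : Fin (M + 18 + 1) ≃ (Fin M ⊕ Fin 18) ⊕ Fin 1 :=
  finSumFinEquiv.symm.trans (Equiv.sumCongr finSumFinEquiv.symm (Equiv.refl (Fin 1)))

/-- An enumeration of the fcc two-shell pattern (`18` points). -/
def patEnum : Fin 18 ≃ {v : E3 // v ∈ fccTwoShellPattern} :=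
  (Finset.equivFinOfCardEq card_fccTwoShellPattern).symm

/-- The far particles of the comb: `(2 + k/(2M))·e₀`, `k < M`. -/
def combFar (M : ℕ) (k : Fin M) : E3 :=
  (2 + (k : ℝ) / (2 * M)) • EuclideanSpace.single (0 : Fin 3) (1 : ℝ)

/-- Positions of the comb by decoded index. -/
def combPos (M : ℕ) : (Fin M ⊕ Fin 18) ⊕ Fin 1 → E3
  | Sum.inl (Sum.inl k) => combFar M k
  | Sum.inl (Sum.inr q) => (patEnum q : E3)
  | Sum.inr _ => 0

/-- **The collinear comb**: centre `0`, the `18` fcc two-shell pattern points, and `M` far particles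
on `[2, 5/2)·e₀`. -/
def comb (M : ℕ) : Fin (M + 18 + 1) → E3 := fun n => combPos M (combIdx M n)

/-- The index of the centre. -/
def centre (M : ℕ) : Fin (M + 18 + 1) := (combIdx M).symm (Sum.inr 0)

/-- Positions by decoded index. [folklore] -/
theorem comb_symm_apply (M : ℕ) (u : (Fin M ⊕ Fin 18) ⊕ Fin 1) :
    comb M ((combIdx M).symm u) = combPos M u := by
  simp [comb]

/-- The centre sits at the origin. [folklore] -/
theorem comb_centre (M : ℕ) : comb M (centre M) = 0 := by
  rw [centre, comb_symm_apply]; rfl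

/-- `‖(2 + k/(2M))·e₀‖ = 2 + k/(2M)`. [folklore] -/
theorem norm_combFar (M : ℕ) (k : Fin M) : ‖combFar M k‖ = 2 + (k : ℝ) / (2 * M) := by
  have h : (0 : ℝ) ≤ 2 + (k : ℝ) / (2 * M) := by positivity
  rw [combFar, norm_smul, Real.norm_of_nonneg h]
  simp

/-- Far particles are at distance `≥ 2` from the centre. [folklore] -/
theorem two_le_norm_combFar (M : ℕ) (k : Fin M) : 2 ≤ ‖combFar M k‖ := by
  rw [norm_combFar]
  have : (0 : ℝ) ≤ (k : ℝ) / (2 * M) := by positivity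
  linarith

/-- Far particles are at distance `≤ 5/2` from the centre. [folklore] -/
theorem norm_combFar_le {M : ℕ} (k : Fin M) : ‖combFar M k‖ ≤ 5 / 2 := by
  rw [norm_combFar]
  have hM : (0 : ℝ) < M := by
    have : 0 < M := lt_of_le_of_lt (Nat.zero_le _) k.2
    exact_mod_cast this
  have hk : (k : ℝ) < M := by exact_mod_cast k.2
  have : (k : ℝ) / (2 * M) ≤ 1 / 2 := by
    rw [div_le_iff₀ (by positivity)]
    linarith
  linarith

/-- Mutual distances of the far particles: `|k − k'|/(2M)`. [folklore] -/
theorem dist_combFar (M : ℕ) (k k' : Fin M) :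
    dist (combFar M k) (combFar M k') = |(k : ℝ) - k'| / (2 * M) := by
  have hM : (0 : ℝ) < M := by
    have : 0 < M := lt_of_le_of_lt (Nat.zero_le _) k.2
    exact_mod_cast this
  rw [combFar, combFar, dist_eq_norm, ← sub_smul, norm_smul]
  have e : (2 + (k : ℝ) / (2 * M)) - (2 + (k' : ℝ) / (2 * M)) = ((k : ℝ) - k') / (2 * M) := by ring
  rw [e, Real.norm_eq_abs, abs_div, abs_of_pos (by positivity : (0 : ℝ) < 2 * M)]
  simp

/-- Pattern points have norm `≥ 1`. [cite: HalesDSP2012, §1.3] -/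
theorem one_le_norm_pat (q : Fin 18) : 1 ≤ ‖((patEnum q : {v : E3 // v ∈ fccTwoShellPattern}) : E3)‖ := by
  rcases norm_of_mem_fccTwoShellPattern (patEnum q).2 with h | h
  · rw [h]
  · rw [h]
    exact Real.one_le_sqrt.2 (by norm_num)

/-- Pattern points have norm `≤ √2`. [cite: HalesDSP2012, §1.3] -/
theorem norm_pat_le (q : Fin 18) : ‖((patEnum q : {v : E3 // v ∈ fccTwoShellPattern}) : E3)‖ ≤ Real.sqrt 2 :=
  norm_le_sqrt_two_of_mem_twoShellPattern (Or.inl rfl) (patEnum q).2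

/-- Every particle of the comb other than the centre is at distance `≥ 1` from the centre. -/
theorem one_le_norm_combPos (M : ℕ) {u : (Fin M ⊕ Fin 18) ⊕ Fin 1} (hu : u ≠ Sum.inr 0) :
    1 ≤ ‖combPos M u‖ := by
  rcases u with ((k | q) | o)
  · exact le_trans (by norm_num) (two_le_norm_combFar M k)
  · exact one_le_norm_pat q
  · exact absurd (by rw [Subsingleton.elim o 0]) hu

/-- Pairwise distances of the comb by decoded indices: `≥ 1/(2M)`. -/
theorem combPos_separated {M : ℕ} (hM : 1 ≤ M) {u u' : (Fin M ⊕ Fin 18) ⊕ Fin 1} (hne : u ≠ u') :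
    1 / (2 * (M : ℝ)) ≤ dist (combPos M u) (combPos M u') := by
  have hM' : (1 : ℝ) ≤ M := by exact_mod_cast hM
  have hhalf : 1 / (2 * (M : ℝ)) ≤ 1 / 2 :=
    one_div_le_one_div_of_le (by norm_num) (by linarith : (2 : ℝ) ≤ 2 * M)
  have hs : Real.sqrt 2 < 3 / 2 := by
    rw [Real.sqrt_lt' (by norm_num)]; norm_num
  -- the three mixed lower bounds
  have far_pat : ∀ (k : Fin M) (q : Fin 18),
      1 / (2 * (M : ℝ)) ≤ dist (combFar M k) ((patEnum q : {v : E3 // v ∈ fccTwoShellPattern}) : E3) := by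
    intro k q
    rw [dist_eq_norm]
    have h1 := norm_sub_norm_le (combFar M k) ((patEnum q : {v : E3 // v ∈ fccTwoShellPattern}) : E3)
    have h2 := two_le_norm_combFar M k
    have h3 := norm_pat_le q
    linarith
  have far_cen : ∀ k : Fin M, 1 / (2 * (M : ℝ)) ≤ dist (combFar M k) 0 := by
    intro k
    rw [dist_zero_right]
    linarith [two_le_norm_combFar M k]
  have pat_cen : ∀ q : Fin 18,
      1 / (2 * (M : ℝ)) ≤ dist ((patEnum q : {v : E3 // v ∈ fccTwoShellPattern}) : E3) 0 := by
    intro q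
    rw [dist_zero_right]
    linarith [one_le_norm_pat q]
  rcases u with ((k | q) | o) <;> rcases u' with ((k' | q') | o')
  · -- far / far
    show 1 / (2 * (M : ℝ)) ≤ dist (combFar M k) (combFar M k')
    have hkk : k ≠ k' := fun h => hne (by rw [h])
    have hk : (k : ℕ) ≠ k' := fun h => hkk (Fin.ext h)
    have h1 : (1 : ℝ) ≤ |((k : ℕ) : ℝ) - ((k' : ℕ) : ℝ)| := by
      rcases Nat.lt_or_gt_of_ne hk with h | h
      · have : (k : ℝ) + 1 ≤ k' := by exact_mod_cast h
        rw [abs_sub_comm, abs_of_nonneg (by linarith)]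
        linarith
      · have : (k' : ℝ) + 1 ≤ k := by exact_mod_cast h
        rw [abs_of_nonneg (by linarith)]
        linarith
    rw [dist_combFar]
    exact div_le_div_of_nonneg_right h1 (by positivity)
  · exact far_pat k q'
  · show 1 / (2 * (M : ℝ)) ≤ dist (combFar M k) 0
    exact far_cen k
  · show 1 / (2 * (M : ℝ)) ≤ dist ((patEnum q : {v : E3 // v ∈ fccTwoShellPattern}) : E3) (combFar M k')
    rw [dist_comm]; exact far_pat k' q
  · -- pattern / pattern
    show 1 / (2 * (M : ℝ)) ≤ dist ((patEnum q : {v : E3 // v ∈ fccTwoShellPattern}) : E3)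
      ((patEnum q' : {v : E3 // v ∈ fccTwoShellPattern}) : E3)
    have hqq : q ≠ q' := fun h => hne (by rw [h])
    have hvw : ((patEnum q : {v : E3 // v ∈ fccTwoShellPattern}) : E3) ≠
        ((patEnum q' : {v : E3 // v ∈ fccTwoShellPattern}) : E3) := fun h =>
      hqq (patEnum.injective (Subtype.ext h))
    have h1 := one_le_dist_of_mem_fccTwoShellPattern (patEnum q).2 (patEnum q').2 hvw
    linarith
  · show 1 / (2 * (M : ℝ)) ≤ dist ((patEnum q : {v : E3 // v ∈ fccTwoShellPattern}) : E3) 0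
    exact pat_cen q
  · show 1 / (2 * (M : ℝ)) ≤ dist (0 : E3) (combFar M k')
    rw [dist_comm]; exact far_cen k'
  · show 1 / (2 * (M : ℝ)) ≤ dist (0 : E3) ((patEnum q' : {v : E3 // v ∈ fccTwoShellPattern}) : E3)
    rw [dist_comm]; exact pat_cen q'
  · exact absurd (by rw [Subsingleton.elim o o']) hne

/-- **The comb is `1/(2M)`-separated.** -/
theorem comb_separated {M : ℕ} (hM : 1 ≤ M) : Separated (1 / (2 * (M : ℝ))) (comb M) := by
  intro i j hij
  obtain ⟨u, rfl⟩ := (combIdx M).symm.surjective i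
  obtain ⟨u', rfl⟩ := (combIdx M).symm.surjective j
  have hne : u ≠ u' := fun h => hij (by rw [h])
  rw [comb_symm_apply, comb_symm_apply]
  exact combPos_separated hM hne

/-- **The centre of the comb is `1/20`-good** (indeed `0`-good at scale `a = 1`: its
`3/2`-neighbourhood is exactly the fcc two-shell pattern, the far particles being at distance
`≥ 2`). -/
theorem good_centre (M : ℕ) : IsTwoShellGood (1 / 20) (47 / 50) 1 (comb M) (centre M) := by
  classical
  refine ⟨1, by norm_num, le_rfl, LinearIsometry.id, fccTwoShellPattern,
    fun v => if h : v ∈ fccTwoShellPattern then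
      (combIdx M).symm (Sum.inl (Sum.inr (patEnum.symm ⟨v, h⟩))) else centre M,
    Or.inl rfl, ?_, ?_, ?_⟩
  · intro v hv
    refine ⟨?_, ?_⟩
    · dsimp only
      rw [dif_pos hv, centre]
      intro h
      have := (combIdx M).symm.injective h
      simp at this
    · dsimp only
      rw [dif_pos hv, comb_symm_apply, comb_centre]
      simp [combPos]
  · intro v hv w hw hvw
    rw [Finset.mem_coe] at hv hw
    have hvw' : (combIdx M).symm (Sum.inl (Sum.inr (patEnum.symm ⟨v, hv⟩))) =
        (combIdx M).symm (Sum.inl (Sum.inr (patEnum.symm ⟨w, hw⟩))) := by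
      simpa only [dif_pos hv, dif_pos hw] using hvw
    have h1 := (combIdx M).symm.injective hvw'
    simp only [Sum.inl.injEq, Sum.inr.injEq] at h1
    have h2 := patEnum.symm.injective h1
    simpa using congrArg Subtype.val h2
  · intro j hj hdist
    obtain ⟨u, rfl⟩ := (combIdx M).symm.surjective j
    rcases u with ((k | q) | o)
    · exfalso
      rw [comb_symm_apply, comb_centre, dist_zero_right] at hdist
      have h2 := two_le_norm_combFar M k
      change ‖combFar M k‖ ≤ 3 / 2 * 1 at hdist
      linarith
    · refine ⟨patEnum q, (patEnum q).2, ?_⟩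
      simp
    · exfalso
      apply hj
      rw [Subsingleton.elim o 0]
      rfl

/-- **The centre's site energy is `≤ −M/2000`**: the `18` pattern terms are `≤ 0`
(norms `1`, `√2`), the `M` far terms are `≤ −1/2000` each. -/
theorem siteEnergy_centre_le (M : ℕ) :
    siteEnergy lennardJones (comb M) (centre M) ≤ -((M : ℝ) / 2000) := by
  classical
  unfold siteEnergy
  have hsplit := Finset.sum_erase_eq_sub (f := fun k => lennardJones (dist (comb M (centre M)) (comb M k)))
    (Finset.mem_univ (centre M))
  rw [hsplit, dist_self]
  have hV0 : lennardJones 0 = 0 := by norm_num [lennardJones]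
  rw [hV0, sub_zero, comb_centre]
  rw [← Fintype.sum_equiv (combIdx M).symm (fun u => lennardJones (dist (0 : E3) (combPos M u)))
    (fun n => lennardJones (dist (0 : E3) (comb M n))) (fun u => by rw [comb_symm_apply])]
  rw [Fintype.sum_sum_type, Fintype.sum_sum_type]
  have hfar : ∑ k : Fin M, lennardJones (dist (0 : E3) (combPos M (Sum.inl (Sum.inl k)))) ≤
      ∑ _k : Fin M, (-(1 / 2000) : ℝ) := by
    refine Finset.sum_le_sum fun k _ => ?_
    show lennardJones (dist (0 : E3) (combFar M k)) ≤ -(1 / 2000)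
    rw [dist_comm, dist_zero_right]
    exact lennardJones_le_on_annulus (two_le_norm_combFar M k) (norm_combFar_le k)
  have hpat : ∑ q : Fin 18, lennardJones (dist (0 : E3) (combPos M (Sum.inl (Sum.inr q)))) ≤ 0 := by
    refine Finset.sum_nonpos fun q _ => ?_
    show lennardJones (dist (0 : E3) ((patEnum q : {v : E3 // v ∈ fccTwoShellPattern}) : E3)) ≤ 0
    rw [dist_comm, dist_zero_right]
    exact lennardJones_nonpos (one_le_norm_pat q)
  have hone : ∑ o : Fin 1, lennardJones (dist (0 : E3) (combPos M (Sum.inr o))) = 0 := by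
    rw [Fin.sum_univ_one]
    show lennardJones (dist (0 : E3) 0) = 0
    rw [dist_self, hV0]
  rw [Finset.sum_const, Finset.card_univ, Fintype.card_fin, nsmul_eq_mul] at hfar
  rw [hone]
  linarith


/-! ## The crux vocabulary, the variants and the violation -/



/-! ## Read-back vocabulary (definitionally the crux's inline texts) -/

/-- The crux's local predicate (verbatim): the radius-`2` ball of particle `i` is two-way
`η`-matched, after a translation `t`, to a rigid image of a layered set (triangular layers of spacing
`a ∈ [47/50, 1]` in hole registry along a Hägg word, interlayer spacings in `[39a/50, 17a/20]`). -/
def IsLayeredNear {N : ℕ} (η : ℝ) (x : Fin N → E3) (i : Fin N) : Prop :=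
  ∃ (A : EuclideanSpace ℝ (Fin 3) →ₗᵢ[ℝ] EuclideanSpace ℝ (Fin 3)) (t : EuclideanSpace ℝ (Fin 3)) (a : ℝ)
    (s : ℤ → ℤ) (z : ℤ → ℝ), 47 / 50 ≤ a ∧ a ≤ 1 ∧ IsHaggSeq s ∧
    (∀ m : ℤ, 39 / 50 * a ≤ z (m + 1) - z m ∧ z (m + 1) - z m ≤ 17 / 20 * a) ∧
    let S : Set (EuclideanSpace ℝ (Fin 3)) := {p | ∃ m i j : ℤ, p = A (((i : ℝ) • triangularVec₁ a) +
      ((j : ℝ) • triangularVec₂ a) + ((haggLabel s m : ℝ) • barlowOffset a) + (z m • layerNormal 1))};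
    (∀ j : Fin N, dist (x j) (x i) ≤ 2 → ∃ p ∈ S, dist (x j + t) p ≤ η) ∧
      (∀ p ∈ S, dist p (x i + t) ≤ 2 → ∃ j : Fin N, dist (x j + t) p ≤ η)

/-- `#NL_η(Ω)`: the number of particles of `Ω` whose `2`-ball is NOT `η`-layered (verbatim). -/
def nlCount {N : ℕ} (η : ℝ) (x : Fin N → E3) (Ω : Finset (Fin N)) : ℕ :=
  Nat.card {i : Fin N // i ∈ Ω ∧ ¬ IsLayeredNear η x i}

/-- `#∂_r Ω`: the number of particles of `Ω` with a particle outside `Ω` within distance `r`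
(the crux has `r = 4`). -/
def bdCount {N : ℕ} (r : ℝ) (x : Fin N → E3) (Ω : Finset (Fin N)) : ℕ :=
  Nat.card {i : Fin N // i ∈ Ω ∧ ∃ j : Fin N, j ∉ Ω ∧ dist (x j) (x i) ≤ r}

/-- `Σ_{i ∈ Ω} (e_i − e*)` with `e_i = ½ · siteEnergy` (verbatim the crux's right-hand side). -/
def excessSum {N : ℕ} (x : Fin N → E3) (Ω : Finset (Fin N)) : ℝ :=
  ∑ i ∈ Ω, ((1 / 2 : ℝ) * siteEnergy lennardJones x i - eStar)

/-- The crux with the boundary collar radius `4` replaced by a parameter `r`. -/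
def NearFieldConvexityRadius (r : ℝ) : Prop :=
  ∀ δ : ℝ, 0 < δ → ∀ η : ℝ, 0 < η → ∃ c : ℝ, 0 < c ∧ ∃ C : ℝ, ∀ (N : ℕ) (x : Fin N → E3),
    Separated δ x → ∀ Ω : Finset (Fin N), (∀ i ∈ Ω, IsTwoShellGood (1 / 20) (47 / 50) 1 x i) →
      c * (nlCount η x Ω : ℝ) - C * (bdCount r x Ω : ℝ) ≤ excessSum x Ω

/-- READ-BACK: the crux is, definitionally, `NearFieldConvexityRadius 4`. [folklore] -/
theorem nearFieldConvexity_iff_radius : NearFieldConvexity ↔ NearFieldConvexityRadius 4 := Iff.rfl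

/-- The crux with the SEPARATION hypothesis dropped (so `c, C` must serve every configuration). -/
def NearFieldConvexityWithoutSeparation : Prop :=
  ∀ δ : ℝ, 0 < δ → ∀ η : ℝ, 0 < η → ∃ c : ℝ, 0 < c ∧ ∃ C : ℝ, ∀ (N : ℕ) (x : Fin N → E3),
    ∀ Ω : Finset (Fin N), (∀ i ∈ Ω, IsTwoShellGood (1 / 20) (47 / 50) 1 x i) →
      c * (nlCount η x Ω : ℝ) - C * (bdCount 4 x Ω : ℝ) ≤ excessSum x Ω

/-- The crux with the constants chosen BEFORE `δ` (uniform in the separation; they may still depend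
on `η`). -/
def NearFieldConvexityUniform : Prop :=
  ∀ η : ℝ, 0 < η → ∃ c : ℝ, 0 < c ∧ ∃ C : ℝ, ∀ δ : ℝ, 0 < δ → ∀ (N : ℕ) (x : Fin N → E3),
    Separated δ x → ∀ Ω : Finset (Fin N), (∀ i ∈ Ω, IsTwoShellGood (1 / 20) (47 / 50) 1 x i) →
      c * (nlCount η x Ω : ℝ) - C * (bdCount 4 x Ω : ℝ) ≤ excessSum x Ω

/-- The crux WITHOUT THE BOUNDARY CHARGE (`C = 0`). -/
def NearFieldConvexityWithoutBoundaryCharge : Prop :=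
  ∀ δ : ℝ, 0 < δ → ∀ η : ℝ, 0 < η → ∃ c : ℝ, 0 < c ∧ ∀ (N : ℕ) (x : Fin N → E3),
    Separated δ x → ∀ Ω : Finset (Fin N), (∀ i ∈ Ω, IsTwoShellGood (1 / 20) (47 / 50) 1 x i) →
      c * (nlCount η x Ω : ℝ) ≤ excessSum x Ω

/-! ## Scalar facts -/

/-- `e* ≥ −2³²/12` (finite stability through blocks, `ChargedEnergyGapNegative.Blocks`). [folklore] -/
theorem neg_le_eStar : -(65536 ^ 2 / 12 : ℝ) ≤ eStar :=
  le_ciInf fun Q =>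
    Summit.AtomisticToContinuum.Crystallization.Theorems.ChargedEnergyGapNegative.Blocks.neg_le_energyPerParticle Q

/-! ## The violation -/

/-- `Ω = {i₀}` has at most one boundary particle. -/
theorem bdCount_singleton_le_one {N : ℕ} (r : ℝ) (x : Fin N → E3) (i₀ : Fin N) :
    bdCount r x {i₀} ≤ 1 := by
  unfold bdCount
  refine Finite.card_le_one_iff_subsingleton.2 ⟨fun a b => Subtype.ext ?_⟩
  exact (Finset.mem_singleton.1 a.2.1).trans (Finset.mem_singleton.1 b.2.1).symm

/-- For the comb and a collar radius `r < 1`, `Ω = {centre}` has NO boundary particle. -/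
theorem bdCount_centre_eq_zero (M : ℕ) {r : ℝ} (hr : r < 1) : bdCount r (comb M) {centre M} = 0 := by
  unfold bdCount
  rw [Nat.card_eq_zero]
  left
  refine ⟨fun ⟨i, hi, j, hj, hd⟩ => ?_⟩
  rw [Finset.mem_singleton] at hi hj
  subst hi
  obtain ⟨u, rfl⟩ := (combIdx M).symm.surjective j
  have hu : u ≠ Sum.inr 0 := fun h => hj (by rw [h]; rfl)
  rw [comb_symm_apply, comb_centre, dist_zero_right] at hd
  have := one_le_norm_combPos M hu
  linarith

/-- `Σ_{i ∈ {i₀}} (e_i − e*) = e_{i₀} − e*`. [folklore] -/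
theorem excessSum_singleton {N : ℕ} (x : Fin N → E3) (i₀ : Fin N) :
    excessSum x {i₀} = 1 / 2 * siteEnergy lennardJones x i₀ - eStar :=
  Finset.sum_singleton _ _

/-- **The comb violates the near-field inequality at `Ω = {centre}`** for every `c > 0`, every
`C` with `4000·(2³²/12 + |C| + 1) ≤ M`, every collar radius and every `η`. [folklore] -/
theorem comb_violates {c C r η : ℝ} (hc : 0 < c) {M : ℕ}
    (hbig : 4000 * (65536 ^ 2 / 12 + |C| + 1) ≤ (M : ℝ)) :
    ¬ (c * (nlCount η (comb M) {centre M} : ℝ) - C * (bdCount r (comb M) {centre M} : ℝ) ≤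
        excessSum (comb M) {centre M}) := by
  intro h
  rw [excessSum_singleton] at h
  have h1 : 0 ≤ c * (nlCount η (comb M) {centre M} : ℝ) := mul_nonneg hc.le (Nat.cast_nonneg _)
  have hb : (bdCount r (comb M) {centre M} : ℝ) ≤ 1 := by
    exact_mod_cast bdCount_singleton_le_one r (comb M) (centre M)
  have hb0 : (0 : ℝ) ≤ (bdCount r (comb M) {centre M} : ℝ) := Nat.cast_nonneg _
  have h2 : C * (bdCount r (comb M) {centre M} : ℝ) ≤ |C| :=
    calc C * (bdCount r (comb M) {centre M} : ℝ) ≤ |C| * (bdCount r (comb M) {centre M} : ℝ) :=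
          mul_le_mul_of_nonneg_right (le_abs_self C) hb0
      _ ≤ |C| * 1 := mul_le_mul_of_nonneg_left hb (abs_nonneg C)
      _ = |C| := mul_one _
  have h3 := siteEnergy_centre_le M
  have h4 := neg_le_eStar
  linarith

/-- A large enough `M`. -/
theorem exists_big (C : ℝ) : ∃ M : ℕ, 1 ≤ M ∧ 4000 * (65536 ^ 2 / 12 + |C| + 1) ≤ (M : ℝ) := by
  obtain ⟨M, hM⟩ := exists_nat_ge (4000 * (65536 ^ 2 / 12 + |C| + 1))
  refine ⟨M, ?_, hM⟩
  have h0 : (1 : ℝ) ≤ 4000 * (65536 ^ 2 / 12 + |C| + 1) := by nlinarith [abs_nonneg C]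
  exact_mod_cast h0.trans hM

/-- `Ω = {centre}` consists of good particles. [folklore] -/
theorem good_of_mem_centre (M : ℕ) :
    ∀ i ∈ ({centre M} : Finset (Fin (M + 18 + 1))), IsTwoShellGood (1 / 20) (47 / 50) 1 (comb M) i := by
  intro i hi
  rw [Finset.mem_singleton] at hi
  rw [hi]
  exact good_centre M

/-- `0 < 1/(2M)`. [folklore] -/
theorem sep_pos {M : ℕ} (hM : 1 ≤ M) : (0 : ℝ) < 1 / (2 * (M : ℝ)) := by
  have : (0 : ℝ) < M := by exact_mod_cast hM
  positivity

/-! ## The four negative facts -/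

/-- **Separation is load-bearing**: with the `δ`-separation hypothesis dropped, `NearFieldConvexity`
is FALSE (the comb with `M → ∞`: a lone good particle next to arbitrarily dense far matter has site
energy `→ −∞`, while `Ω = {centre}` has one boundary particle). [folklore] -/
theorem nearFieldConvexity_false_without_separation : ¬ NearFieldConvexityWithoutSeparation := by
  intro h
  obtain ⟨c, hc, C, h⟩ := h 1 one_pos 1 one_pos
  obtain ⟨M, hM, hbig⟩ := exists_big C
  exact comb_violates hc hbig (h _ (comb M) {centre M} (good_of_mem_centre M))

/-- **The constants cannot be uniform in `δ`**: `∃ c, C ∀ δ` (after `η`) is FALSE — the comb is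
`1/(2M)`-separated and beats every fixed `C` as `M → ∞`; any proof has `C(δ) → ∞` as `δ → 0`.
[folklore] -/
theorem not_nearFieldConvexityUniform : ¬ NearFieldConvexityUniform := by
  intro h
  obtain ⟨c, hc, C, h⟩ := h 1 one_pos
  obtain ⟨M, hM, hbig⟩ := exists_big C
  exact comb_violates hc hbig
    (h _ (sep_pos hM) _ (comb M) (comb_separated hM) {centre M} (good_of_mem_centre M))

/-- **The boundary charge is load-bearing**: with `C = 0` the statement is FALSE at
`δ = 1/(2M)`, `M = ⌈4000·(2³²/12 + 1)⌉`: the good centre of the comb has `e_centre < e*`. [folklore] -/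
theorem nearFieldConvexity_false_without_boundaryCharge : ¬ NearFieldConvexityWithoutBoundaryCharge := by
  intro h
  obtain ⟨M, hM, hbig⟩ := exists_big 0
  obtain ⟨c, hc, h⟩ := h _ (sep_pos hM) 1 one_pos
  have key := h _ (comb M) (comb_separated hM) {centre M} (good_of_mem_centre M)
  refine comb_violates (C := 0) (r := 4) (η := 1) hc hbig ?_
  rw [zero_mul, sub_zero]
  exact key

/-- **The boundary collar must reach the contact distance**: for every radius `r < 1` the crux with
`#∂_r Ω` in place of `#∂₄ Ω` is FALSE (the collar of the lone good centre is then empty, so the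
boundary charge is void and the previous witness applies). [folklore] -/
theorem not_nearFieldConvexityRadius_of_lt_one {r : ℝ} (hr : r < 1) : ¬ NearFieldConvexityRadius r := by
  intro h
  obtain ⟨M, hM, hbig⟩ := exists_big 0
  obtain ⟨c, hc, C, h⟩ := h _ (sep_pos hM) 1 one_pos
  have key := h _ (comb M) (comb_separated hM) {centre M} (good_of_mem_centre M)
  rw [bdCount_centre_eq_zero M hr, Nat.cast_zero, mul_zero, sub_zero] at key
  refine comb_violates (C := 0) (r := r) (η := 1) hc hbig ?_
  rw [zero_mul, sub_zero]
  exact key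


/-! ## (e) The far-field content isolated: the boundary floor and the interface bound -/

/-- The BOUNDARY FLOOR: `Σ_{i∈Ω}(e_i − e*) ≥ −C(δ)·#∂₄Ω` for every `δ`-separated `x` and every good
`Ω` — the `c = 0` shadow of the crux (pure far-field content: periodisation floor + interface
bound).  Necessary (`nearFieldConvexity_implies_floor`); believed true; not yet in the tree. -/
def BoundaryFloor : Prop :=
  ∀ δ : ℝ, 0 < δ → ∃ C : ℝ, ∀ (N : ℕ) (x : Fin N → E3), Separated δ x →
    ∀ Ω : Finset (Fin N), (∀ i ∈ Ω, IsTwoShellGood (1 / 20) (47 / 50) 1 x i) →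
      -(C * (bdCount 4 x Ω : ℝ)) ≤ excessSum x Ω

/-- The crux implies the boundary floor (drop the non-negative `c`-term at `η = 1`). [folklore] -/
theorem nearFieldConvexity_implies_floor (h : NearFieldConvexity) : BoundaryFloor := by
  intro δ hδ
  obtain ⟨c, hc, C, h⟩ := (nearFieldConvexity_iff_radius.1 h) δ hδ 1 one_pos
  refine ⟨C, fun N x hsep Ω hΩ => ?_⟩
  have key := h N x hsep Ω hΩ
  have h1 : 0 ≤ c * (nlCount 1 x Ω : ℝ) := mul_nonneg hc.le (Nat.cast_nonneg _)
  linarith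

/-- The INTERFACE BOUND every proof architecture needs (lead's NOTES §Interface; FarFieldGapR's
TailCharge child): the sixth-power pull of the matter outside `Ω` on the radius-`4` interior of a
good `Ω` is boundary-summable.  Stated for the record (believed TRUE: `r⁻⁶` is integrable at
infinity in `ℝ³`, so the pull is interface-local; small cavities radiate `d⁻⁶`). -/
def InterfaceBound : Prop :=
  ∀ δ : ℝ, 0 < δ → ∃ K : ℝ, ∀ (N : ℕ) (x : Fin N → E3), Separated δ x →
    ∀ Ω : Finset (Fin N), (∀ i ∈ Ω, IsTwoShellGood (1 / 20) (47 / 50) 1 x i) →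
      (∑ i ∈ Ω.filter (fun i => ∀ j : Fin N, dist (x j) (x i) ≤ 4 → j ∈ Ω),
          ∑ j ∈ Finset.univ.filter (fun j => j ∉ Ω), (dist (x i) (x j))⁻¹ ^ 6) ≤
        K * (bdCount 4 x Ω : ℝ)

end Summit.AtomisticToContinuum.Crystallization.Cruxes.NearFieldConvexity.Disproof
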